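import Mathlib
import Literature.Analysis.FunctionSpaces.TorusConvectionLaplacianNormSq
import Literature.Analysis.FunctionSpaces.TorusFluidGlueProofs
import Literature.Analysis.FunctionSpaces.TorusTestFunction
import Literature.Analysis.FluidPDE.NavierStokesConcentrationTools
import Literature.Analysis.FunctionSpaces.TorusLinearisedFormTruncation
import Summits.NavierStokesRegularity.FluidComputer.LaplacianConvectCommutator
import HarnessLib

/-!
# Sharp `H²` transport and stretching fluxes on the torus — the linearised balance without `ν⁻¹` (instab g8, cell `ns-blowup`, 2026-08-25)

HONEST FRAMING (human ruling D-0035): nothing here is a claim about Navier–Stokes blow-up.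
WHAT THIS IS NOT: not NS evidence. The quantitative corollary of `LaplacianConvectCommutator`
(`laplacian_convect` + the `H²` skew identity): for smooth divergence-free `v` with `‖∂ₖv‖ ≤ L`,
`‖Δv‖ ≤ L₂` and smooth `w`,
`|∫ ⟪(v·∇)w, ΔΔw⟫| ≤ (2L·(∑ₘ∑ⱼ ‖∂ⱼ∂ₘw‖₂) + L₂·(∑ⱼ ‖∂ⱼw‖₂)) · ‖Δw‖₂`
— FIRST order in the drift's derivatives and free of `ν⁻¹`, in contrast with the Young-inequality form
of the tree's `Torus.linearisedNS_laplacian_flux_le`. This is the transport half of the tail inequality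
of THEOREM 3-L (`instab/INSTAB-BRIDGE.md` §11 l.109; for `U = abc(1,1,1)`: `L`-type constant `√3`,
`L₂ = √6` because `ΔU = −U`) and of LEMMA R (R2′)/(R3′) of `CERT-ROPE-X0.md` §C.

* `abs_integral_inner_convect_bilaplacian_le` — the bound above (Green's second identity, the skew
  identity, pointwise `‖(a·∇)b‖ ≤ ‖a‖∑ⱼ‖∂ⱼb‖`, Cauchy–Schwarz per product).
* `abs_integral_inner_stretch_bilaplacian_le` — the STRETCHING half:
  `|∫ ⟪(w·∇)v, ΔΔw⟫| ≤ d·(L''‖w‖₂ + 2L'·∑ₘ‖∂ₘw‖₂ + L‖Δw‖₂)·‖Δw‖₂` for smooth `v` with pointwise bounds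
  `L, L', L''` on `∂v`, `∂∂v`, `∂Δv` (Leibniz rule `laplacian_convect` with the fields exchanged; no
  divergence condition) — together the two give the `H²` balance of the linearised operator
  `νΔ − (U·∇) − (·∇)U` with constants LINEAR in the host's derivative bounds
  (`abs_integral_inner_linearised_bilaplacian_le`, the sum of the two).

Mathlib + Literature + the landed `LaplacianConvectCommutator`; no new definitions.
-/

noncomputable section

namespace Summit.NavierStokesRegularity.FluidComputer.LaplacianConvectFlux

open Summit.NavierStokesRegularity.FluidComputer.LaplacianConvectCommutator

open Literature.Analysis.FunctionSpaces Literature.Analysis.FunctionSpaces.Torus MeasureTheory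
open scoped RealInnerProductSpace

variable {d : Type*} [Fintype d] [DecidableEq d]
variable {F : Type*} [NormedAddCommGroup F] [InnerProductSpace ℝ F]

/-- **Sharp `H²` transport flux (no `ν⁻¹`).** For smooth divergence-free `v` with
`‖∂ₖv‖ ≤ L`, `‖Δv‖ ≤ L₂` pointwise and smooth `w`:
`|∫ ⟪(v·∇)w, ΔΔw⟫| ≤ (2L·(∑ₘ∑ⱼ ‖∂ⱼ∂ₘw‖₂) + L₂·(∑ⱼ ‖∂ⱼw‖₂)) · ‖Δw‖₂`
(`‖·‖₂ = (∫‖·‖²)^{1/2}`). Green's second identity moves one Laplacian across, the `H²` skew identity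
kills the top-order term, and what is left is first order in `v`'s derivatives — contrast the tree's
Young-inequality form `Torus.linearisedNS_laplacian_flux_le` (`ν⁻¹M²`-type constants). This is the
transport half of the tail inequality of THEOREM 3-L (§11 l.109: for `U = abc(1,1,1)`, `L`-type
constant `√3`, `L₂ = √6` since `ΔU = −U`). -/
theorem abs_integral_inner_convect_bilaplacian_le {v w : UnitAddTorus d → EuclideanSpace ℝ d}
    (hv : IsSmooth v) (hdiv : IsDivFree v) (hw : IsSmooth w) {L L₂ : ℝ} (hL0 : 0 ≤ L)
    (hL : ∀ (k : d) (x : UnitAddTorus d), ‖partialDeriv k v x‖ ≤ L)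
    (hL₂ : ∀ x : UnitAddTorus d, ‖laplacian v x‖ ≤ L₂) :
    |∫ x, ⟪convect v w x, laplacian (laplacian w) x⟫|
      ≤ (2 * L * (∑ m, ∑ j, Real.sqrt (∫ x, ‖partialDeriv j (partialDeriv m w) x‖ ^ 2))
          + L₂ * (∑ j, Real.sqrt (∫ x, ‖partialDeriv j w x‖ ^ 2)))
        * Real.sqrt (∫ x, ‖laplacian w x‖ ^ 2) := by
  have hΔw : IsSmooth (laplacian w) := hw.laplacian
  have hcw : IsSmooth (convect v w) := hv.convect hw
  -- Green: `∫ ⟪(v·∇)w, ΔΔw⟫ = ∫ ⟪Δ((v·∇)w), Δw⟫`, then the skew identity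
  have hgreen : ∫ x, ⟪convect v w x, laplacian (laplacian w) x⟫
      = ∫ x, ⟪laplacian (convect v w) x, laplacian w x⟫ :=
    (integral_inner_laplacian_comm hcw hΔw).symm
  set R : UnitAddTorus d → EuclideanSpace ℝ d := fun x =>
    (2:ℝ) • (∑ m, convect (partialDeriv m v) (partialDeriv m w) x) + convect (laplacian v) w x with hR
  have hskew : ∫ x, ⟪laplacian (convect v w) x, laplacian w x⟫ = ∫ x, ⟪R x, laplacian w x⟫ :=
    integral_inner_laplacian_convect_laplacian hv hdiv hw
  rw [hgreen, hskew]
  -- abbreviations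
  set a : d → d → UnitAddTorus d → ℝ := fun m j x => ‖partialDeriv j (partialDeriv m w) x‖ with ha
  set b : d → UnitAddTorus d → ℝ := fun j x => ‖partialDeriv j w x‖ with hb
  set c : UnitAddTorus d → ℝ := fun x => ‖laplacian w x‖ with hc
  have ha0 : ∀ m j x, 0 ≤ a m j x := fun m j x => norm_nonneg _
  have hb0 : ∀ j x, 0 ≤ b j x := fun j x => norm_nonneg _
  have hc0 : ∀ x, 0 ≤ c x := fun x => norm_nonneg _
  have hL20 : 0 ≤ L₂ := (norm_nonneg _).trans (hL₂ (0 : UnitAddTorus d))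
  -- pointwise bound on `R`
  have hRpt : ∀ x, ‖R x‖ ≤ 2 * L * (∑ m, ∑ j, a m j x) + L₂ * (∑ j, b j x) := by
    intro x
    have hS : ‖∑ m, convect (partialDeriv m v) (partialDeriv m w) x‖ ≤ L * (∑ m, ∑ j, a m j x) := by
      calc ‖∑ m, convect (partialDeriv m v) (partialDeriv m w) x‖
          ≤ ∑ m, ‖convect (partialDeriv m v) (partialDeriv m w) x‖ := norm_sum_le _ _
        _ ≤ ∑ m, L * (∑ j, a m j x) := by
            refine Finset.sum_le_sum fun m _ => ?_
            have hcv := norm_convect_le (partialDeriv m v)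
              (((hw.partialDeriv m)).isContDiff (by simp)) x
            have hs : 0 ≤ ∑ j, a m j x := Finset.sum_nonneg fun j _ => ha0 m j x
            exact hcv.trans (mul_le_mul_of_nonneg_right (hL m x) hs)
        _ = L * (∑ m, ∑ j, a m j x) := by rw [Finset.mul_sum]
    have h1 : ‖(2:ℝ) • (∑ m, convect (partialDeriv m v) (partialDeriv m w) x)‖
        ≤ 2 * L * (∑ m, ∑ j, a m j x) := by
      rw [norm_smul, Real.norm_two]; nlinarith [hS]
    have h2 : ‖convect (laplacian v) w x‖ ≤ L₂ * (∑ j, b j x) := by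
      have hcv := norm_convect_le (laplacian v) (hw.isContDiff (by simp)) x
      have hs : 0 ≤ ∑ j, b j x := Finset.sum_nonneg fun j _ => hb0 j x
      exact hcv.trans (mul_le_mul_of_nonneg_right (hL₂ x) hs)
    exact (norm_add_le _ _).trans (add_le_add h1 h2)
  -- smoothness / continuity facts
  have hRs : IsSmooth R := by
    have hs : IsSmooth (fun x => ∑ m, convect (partialDeriv m v) (partialDeriv m w) x) := by
      have hl : lift (fun x => ∑ m, convect (partialDeriv m v) (partialDeriv m w) x)
          = fun z => ∑ m, lift (convect (partialDeriv m v) (partialDeriv m w)) z := rfl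
      unfold IsSmooth; rw [hl]
      exact ContDiff.sum fun m _ => ((hv.partialDeriv m).convect (hw.partialDeriv m))
    have h := (hs.smul (2:ℝ)).add (hv.laplacian.convect hw)
    have e : R = ((2:ℝ) • (fun x => ∑ m, convect (partialDeriv m v) (partialDeriv m w) x)
        + convect (laplacian v) w) := by funext x; simp [hR]
    rw [e]; exact h
  have hca : ∀ m j, Continuous (a m j) := fun m j => (((hw.partialDeriv m).partialDeriv j).continuous).norm
  have hcb : ∀ j, Continuous (b j) := fun j => ((hw.partialDeriv j).continuous).norm
  have hcc : Continuous c := hΔw.continuous.norm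
  have hI1 : ∀ m j, Integrable (fun x => a m j x * c x) volume := fun m j =>
    ((hca m j).mul hcc).integrable_of_hasCompactSupport (HasCompactSupport.of_compactSpace _)
  have hI2 : ∀ j, Integrable (fun x => b j x * c x) volume := fun j =>
    ((hcb j).mul hcc).integrable_of_hasCompactSupport (HasCompactSupport.of_compactSpace _)
  -- |∫ ⟪R, Δw⟫| ≤ ∫ ‖R‖ ‖Δw‖
  have hint_le : |∫ x, ⟪R x, laplacian w x⟫| ≤ ∫ x, ‖R x‖ * c x := by
    refine (abs_integral_le_integral_abs).trans (integral_mono_of_nonneg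
      (ae_of_all _ fun x => abs_nonneg _) ?_ (ae_of_all _ fun x => abs_real_inner_le_norm _ _))
    exact (hRs.continuous.norm.mul hcc).integrable_of_hasCompactSupport
      (HasCompactSupport.of_compactSpace _)
  -- ∫ ‖R‖ c ≤ ∫ B with B the expanded bound
  set B : UnitAddTorus d → ℝ := fun x =>
    2 * L * (∑ m, ∑ j, a m j x * c x) + L₂ * (∑ j, b j x * c x) with hB
  have hBI : Integrable B volume := by
    have h1 : Integrable (fun x => ∑ m, ∑ j, a m j x * c x) volume :=
      integrable_finsetSum _ fun m _ => integrable_finsetSum _ fun j _ => hI1 m j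
    have h2 : Integrable (fun x => ∑ j, b j x * c x) volume := integrable_finsetSum _ fun j _ => hI2 j
    exact (h1.const_mul _).add (h2.const_mul _)
  have hmono : ∫ x, ‖R x‖ * c x ≤ ∫ x, B x := by
    refine integral_mono_of_nonneg (ae_of_all _ fun x => mul_nonneg (norm_nonneg _) (hc0 x)) hBI
      (ae_of_all _ fun x => ?_)
    have h := mul_le_mul_of_nonneg_right (hRpt x) (hc0 x)
    have e1 : (∑ m, ∑ j, a m j x) * c x = ∑ m, ∑ j, a m j x * c x := by
      rw [Finset.sum_mul]; exact Finset.sum_congr rfl fun m _ => Finset.sum_mul _ _ _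
    have e2 : (∑ j, b j x) * c x = ∑ j, b j x * c x := Finset.sum_mul _ _ _
    have e : (2 * L * (∑ m, ∑ j, a m j x) + L₂ * (∑ j, b j x)) * c x = B x := by
      simp only [hB]; rw [← e1, ← e2]; ring
    rw [← e]; exact h
  -- ∫ B = 2L ΣΣ ∫ a c + L₂ Σ ∫ b c
  have hBint : ∫ x, B x = 2 * L * (∑ m, ∑ j, ∫ x, a m j x * c x) + L₂ * (∑ j, ∫ x, b j x * c x) := by
    have h1 : ∫ x, (∑ m, ∑ j, a m j x * c x) = ∑ m, ∑ j, ∫ x, a m j x * c x := by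
      rw [integral_finsetSum _ (fun m _ => integrable_finsetSum _ fun j _ => hI1 m j)]
      exact Finset.sum_congr rfl fun m _ => integral_finsetSum _ fun j _ => hI1 m j
    have h2 : ∫ x, (∑ j, b j x * c x) = ∑ j, ∫ x, b j x * c x :=
      integral_finsetSum _ (fun j _ => hI2 j)
    have hi1 : Integrable (fun x => ∑ m, ∑ j, a m j x * c x) volume :=
      integrable_finsetSum _ fun m _ => integrable_finsetSum _ fun j _ => hI1 m j
    have hi2 : Integrable (fun x => ∑ j, b j x * c x) volume := integrable_finsetSum _ fun j _ => hI2 j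
    simp only [hB]
    rw [integral_add (hi1.const_mul _) (hi2.const_mul _), integral_const_mul, integral_const_mul, h1, h2]
  -- Cauchy–Schwarz per product
  have hCS1 : ∀ m j, ∫ x, a m j x * c x
      ≤ Real.sqrt (∫ x, a m j x ^ 2) * Real.sqrt (∫ x, c x ^ 2) := fun m j =>
    integral_norm_mul_norm_le_sqrt_sq_mul_sqrt_sq
      (((hw.partialDeriv m).partialDeriv j).memLp 2) (hΔw.memLp 2)
  have hCS2 : ∀ j, ∫ x, b j x * c x ≤ Real.sqrt (∫ x, b j x ^ 2) * Real.sqrt (∫ x, c x ^ 2) := fun j =>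
    integral_norm_mul_norm_le_sqrt_sq_mul_sqrt_sq ((hw.partialDeriv j).memLp 2) (hΔw.memLp 2)
  have hsum1 : (∑ m, ∑ j, ∫ x, a m j x * c x)
      ≤ ∑ m, ∑ j, Real.sqrt (∫ x, a m j x ^ 2) * Real.sqrt (∫ x, c x ^ 2) :=
    Finset.sum_le_sum fun m _ => Finset.sum_le_sum fun j _ => hCS1 m j
  have hsum2 : (∑ j, ∫ x, b j x * c x) ≤ ∑ j, Real.sqrt (∫ x, b j x ^ 2) * Real.sqrt (∫ x, c x ^ 2) :=
    Finset.sum_le_sum fun j _ => hCS2 j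
  calc |∫ x, ⟪R x, laplacian w x⟫|
      ≤ ∫ x, ‖R x‖ * c x := hint_le
    _ ≤ ∫ x, B x := hmono
    _ = 2 * L * (∑ m, ∑ j, ∫ x, a m j x * c x) + L₂ * (∑ j, ∫ x, b j x * c x) := hBint
    _ ≤ 2 * L * (∑ m, ∑ j, Real.sqrt (∫ x, a m j x ^ 2) * Real.sqrt (∫ x, c x ^ 2))
        + L₂ * (∑ j, Real.sqrt (∫ x, b j x ^ 2) * Real.sqrt (∫ x, c x ^ 2)) := by
        have h2L : 0 ≤ 2 * L := by linarith
        exact add_le_add (mul_le_mul_of_nonneg_left hsum1 h2L) (mul_le_mul_of_nonneg_left hsum2 hL20)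
    _ = (2 * L * (∑ m, ∑ j, Real.sqrt (∫ x, a m j x ^ 2)) + L₂ * (∑ j, Real.sqrt (∫ x, b j x ^ 2)))
        * Real.sqrt (∫ x, c x ^ 2) := by
        have f1 : (∑ m, ∑ j, Real.sqrt (∫ x, a m j x ^ 2) * Real.sqrt (∫ x, c x ^ 2))
            = (∑ m, ∑ j, Real.sqrt (∫ x, a m j x ^ 2)) * Real.sqrt (∫ x, c x ^ 2) := by
          rw [Finset.sum_mul]; exact Finset.sum_congr rfl fun m _ => (Finset.sum_mul _ _ _).symm
        have f2 : (∑ j, Real.sqrt (∫ x, b j x ^ 2) * Real.sqrt (∫ x, c x ^ 2))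
            = (∑ j, Real.sqrt (∫ x, b j x ^ 2)) * Real.sqrt (∫ x, c x ^ 2) := (Finset.sum_mul _ _ _).symm
        rw [f1, f2]; ring

/-- **`H²` stretching flux (explicit, derivative bounds of the stretched field only).** For smooth `v`
with `‖∂ₖv‖ ≤ L`, `‖∂ⱼ∂ₖv‖ ≤ L'`, `‖∂ⱼ(Δv)‖ ≤ L''` pointwise and smooth `w` (no divergence condition):
`|∫ ⟪(w·∇)v, ΔΔw⟫| ≤ d·(L''‖w‖₂ + 2L'·∑ₘ‖∂ₘw‖₂ + L‖Δw‖₂)·‖Δw‖₂` (`d = card` of the index type),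
by Green's identity, `Δ((w·∇)v) = (w·∇)Δv + 2∑ₘ(∂ₘw·∇)∂ₘv + (Δw·∇)v` (`laplacian_convect` with the
two fields exchanged), `‖(a·∇)b‖ ≤ ‖a‖∑ⱼ‖∂ⱼb‖` and Cauchy–Schwarz. For `U = abc(1,1,1)` all three
bounds are `O(1)` (entries are single trigonometric monomials; `∂ⱼΔU = −∂ⱼU`), so the stretching part
of the `H²` balance is `O(‖w‖²_{H²})` with displayed constants — the second half of 3-L's tail. -/
theorem abs_integral_inner_stretch_bilaplacian_le {v w : UnitAddTorus d → EuclideanSpace ℝ d}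
    (hv : IsSmooth v) (hw : IsSmooth w) {L L' L'' : ℝ} (hL0 : 0 ≤ L) (hL'0 : 0 ≤ L') (hL''0 : 0 ≤ L'')
    (hL : ∀ (k : d) (x : UnitAddTorus d), ‖partialDeriv k v x‖ ≤ L)
    (hL' : ∀ (j k : d) (x : UnitAddTorus d), ‖partialDeriv j (partialDeriv k v) x‖ ≤ L')
    (hL'' : ∀ (j : d) (x : UnitAddTorus d), ‖partialDeriv j (laplacian v) x‖ ≤ L'') :
    |∫ x, ⟪convect w v x, laplacian (laplacian w) x⟫|
      ≤ (Fintype.card d : ℝ) * (L'' * Real.sqrt (∫ x, ‖w x‖ ^ 2)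
          + 2 * L' * (∑ m, Real.sqrt (∫ x, ‖partialDeriv m w x‖ ^ 2))
          + L * Real.sqrt (∫ x, ‖laplacian w x‖ ^ 2))
        * Real.sqrt (∫ x, ‖laplacian w x‖ ^ 2) := by
  have hΔw : IsSmooth (laplacian w) := hw.laplacian
  have hΔv : IsSmooth (laplacian v) := hv.laplacian
  have hcw : IsSmooth (convect w v) := hw.convect hv
  set N : ℝ := (Fintype.card d : ℝ) with hN
  have hN0 : 0 ≤ N := Nat.cast_nonneg _
  have hgreen : ∫ x, ⟪convect w v x, laplacian (laplacian w) x⟫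
      = ∫ x, ⟪laplacian (convect w v) x, laplacian w x⟫ :=
    (integral_inner_laplacian_comm hcw hΔw).symm
  set R : UnitAddTorus d → EuclideanSpace ℝ d := fun x => laplacian (convect w v) x with hR
  -- abbreviations
  set a : UnitAddTorus d → ℝ := fun x => ‖w x‖ with ha
  set b : d → UnitAddTorus d → ℝ := fun m x => ‖partialDeriv m w x‖ with hb
  set c : UnitAddTorus d → ℝ := fun x => ‖laplacian w x‖ with hc
  have hc0 : ∀ x, 0 ≤ c x := fun x => norm_nonneg _
  -- pointwise bound on `R = Δ((w·∇)v)`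
  have hsumL : ∀ x, ∑ j, ‖partialDeriv j (laplacian v) x‖ ≤ N * L'' := by
    intro x
    calc ∑ j, ‖partialDeriv j (laplacian v) x‖ ≤ ∑ _j : d, L'' := Finset.sum_le_sum fun j _ => hL'' j x
      _ = N * L'' := by simp [hN]
  have hsumL' : ∀ m x, ∑ j, ‖partialDeriv j (partialDeriv m v) x‖ ≤ N * L' := by
    intro m x
    calc ∑ j, ‖partialDeriv j (partialDeriv m v) x‖ ≤ ∑ _j : d, L' := Finset.sum_le_sum fun j _ => hL' j m x
      _ = N * L' := by simp [hN]
  have hsumL0 : ∀ x, ∑ j, ‖partialDeriv j v x‖ ≤ N * L := by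
    intro x
    calc ∑ j, ‖partialDeriv j v x‖ ≤ ∑ _j : d, L := Finset.sum_le_sum fun j _ => hL j x
      _ = N * L := by simp [hN]
  have hRpt : ∀ x, ‖R x‖ ≤ N * (L'' * a x + 2 * L' * (∑ m, b m x) + L * c x) := by
    intro x
    have e : R x = convect w (laplacian v) x
        + (2:ℝ) • (∑ m, convect (partialDeriv m w) (partialDeriv m v) x)
        + convect (laplacian w) v x := by
      simp only [hR]; exact laplacian_convect hw hv x
    have h1 : ‖convect w (laplacian v) x‖ ≤ N * L'' * a x := by
      have hcv := norm_convect_le w (hΔv.isContDiff (by simp)) x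
      calc ‖convect w (laplacian v) x‖ ≤ ‖w x‖ * ∑ j, ‖partialDeriv j (laplacian v) x‖ := hcv
        _ ≤ ‖w x‖ * (N * L'') := mul_le_mul_of_nonneg_left (hsumL x) (norm_nonneg _)
        _ = N * L'' * a x := by simp only [ha]; ring
    have h2 : ‖(2:ℝ) • (∑ m, convect (partialDeriv m w) (partialDeriv m v) x)‖
        ≤ 2 * (N * L') * ∑ m, b m x := by
      have hS : ‖∑ m, convect (partialDeriv m w) (partialDeriv m v) x‖ ≤ (N * L') * ∑ m, b m x := by
        calc ‖∑ m, convect (partialDeriv m w) (partialDeriv m v) x‖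
            ≤ ∑ m, ‖convect (partialDeriv m w) (partialDeriv m v) x‖ := norm_sum_le _ _
          _ ≤ ∑ m, (N * L') * b m x := by
              refine Finset.sum_le_sum fun m _ => ?_
              have hcv := norm_convect_le (partialDeriv m w)
                (((hv.partialDeriv m)).isContDiff (by simp)) x
              calc ‖convect (partialDeriv m w) (partialDeriv m v) x‖
                  ≤ ‖partialDeriv m w x‖ * ∑ j, ‖partialDeriv j (partialDeriv m v) x‖ := hcv
                _ ≤ ‖partialDeriv m w x‖ * (N * L') :=
                    mul_le_mul_of_nonneg_left (hsumL' m x) (norm_nonneg _)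
                _ = (N * L') * b m x := by simp only [hb]; ring
          _ = (N * L') * ∑ m, b m x := by rw [Finset.mul_sum]
      rw [norm_smul, Real.norm_two]; nlinarith [hS]
    have h3 : ‖convect (laplacian w) v x‖ ≤ N * L * c x := by
      have hcv := norm_convect_le (laplacian w) (hv.isContDiff (by simp)) x
      calc ‖convect (laplacian w) v x‖ ≤ ‖laplacian w x‖ * ∑ j, ‖partialDeriv j v x‖ := hcv
        _ ≤ ‖laplacian w x‖ * (N * L) := mul_le_mul_of_nonneg_left (hsumL0 x) (norm_nonneg _)
        _ = N * L * c x := by simp only [hc]; ring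
    rw [e]
    calc ‖convect w (laplacian v) x + (2:ℝ) • (∑ m, convect (partialDeriv m w) (partialDeriv m v) x)
          + convect (laplacian w) v x‖
        ≤ ‖convect w (laplacian v) x‖ + ‖(2:ℝ) • (∑ m, convect (partialDeriv m w) (partialDeriv m v) x)‖
          + ‖convect (laplacian w) v x‖ := norm_add₃_le
      _ ≤ N * L'' * a x + 2 * (N * L') * ∑ m, b m x + N * L * c x := add_le_add (add_le_add h1 h2) h3
      _ = N * (L'' * a x + 2 * L' * (∑ m, b m x) + L * c x) := by ring
  -- continuity / integrability
  have hRs : IsSmooth R := hcw.laplacian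
  have hca : Continuous a := hw.continuous.norm
  have hcb : ∀ m, Continuous (b m) := fun m => ((hw.partialDeriv m).continuous).norm
  have hcc : Continuous c := hΔw.continuous.norm
  have hIa : Integrable (fun x => a x * c x) volume :=
    (hca.mul hcc).integrable_of_hasCompactSupport (HasCompactSupport.of_compactSpace _)
  have hIb : ∀ m, Integrable (fun x => b m x * c x) volume := fun m =>
    ((hcb m).mul hcc).integrable_of_hasCompactSupport (HasCompactSupport.of_compactSpace _)
  have hIc : Integrable (fun x => c x * c x) volume :=
    (hcc.mul hcc).integrable_of_hasCompactSupport (HasCompactSupport.of_compactSpace _)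
  have hint_le : |∫ x, ⟪R x, laplacian w x⟫| ≤ ∫ x, ‖R x‖ * c x := by
    refine (abs_integral_le_integral_abs).trans (integral_mono_of_nonneg
      (ae_of_all _ fun x => abs_nonneg _) ?_ (ae_of_all _ fun x => abs_real_inner_le_norm _ _))
    exact (hRs.continuous.norm.mul hcc).integrable_of_hasCompactSupport
      (HasCompactSupport.of_compactSpace _)
  set B : UnitAddTorus d → ℝ := fun x =>
    N * (L'' * (a x * c x) + 2 * L' * (∑ m, b m x * c x) + L * (c x * c x)) with hB
  have hBI : Integrable B volume := by
    have h2 : Integrable (fun x => ∑ m, b m x * c x) volume := integrable_finsetSum _ fun m _ => hIb m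
    exact ((hIa.const_mul _).add (h2.const_mul _) |>.add (hIc.const_mul _)).const_mul _
  have hmono : ∫ x, ‖R x‖ * c x ≤ ∫ x, B x := by
    refine integral_mono_of_nonneg (ae_of_all _ fun x => mul_nonneg (norm_nonneg _) (hc0 x)) hBI
      (ae_of_all _ fun x => ?_)
    have h := mul_le_mul_of_nonneg_right (hRpt x) (hc0 x)
    have e2 : (∑ m, b m x) * c x = ∑ m, b m x * c x := Finset.sum_mul _ _ _
    have e : N * (L'' * a x + 2 * L' * (∑ m, b m x) + L * c x) * c x = B x := by
      simp only [hB]; rw [← e2]; ring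
    rw [← e]; exact h
  have hBint : ∫ x, B x = N * (L'' * (∫ x, a x * c x) + 2 * L' * (∑ m, ∫ x, b m x * c x)
      + L * (∫ x, c x * c x)) := by
    have h2 : ∫ x, (∑ m, b m x * c x) = ∑ m, ∫ x, b m x * c x := integral_finsetSum _ (fun m _ => hIb m)
    have hi2 : Integrable (fun x => ∑ m, b m x * c x) volume := integrable_finsetSum _ fun m _ => hIb m
    have hf1 : Integrable (fun x => L'' * (a x * c x)) volume := hIa.const_mul _
    have hf2 : Integrable (fun x => 2 * L' * ∑ m, b m x * c x) volume := hi2.const_mul _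
    have hf3 : Integrable (fun x => L * (c x * c x)) volume := hIc.const_mul _
    have hf12 : Integrable (fun x => L'' * (a x * c x) + 2 * L' * ∑ m, b m x * c x) volume := hf1.add hf2
    have hin : ∫ x, (L'' * (a x * c x) + 2 * L' * (∑ m, b m x * c x) + L * (c x * c x))
        = L'' * (∫ x, a x * c x) + 2 * L' * (∑ m, ∫ x, b m x * c x) + L * (∫ x, c x * c x) := by
      rw [integral_add hf12 hf3, integral_add hf1 hf2, integral_const_mul, integral_const_mul,
        integral_const_mul, h2]
    simp only [hB]
    rw [integral_const_mul, hin]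
  -- Cauchy–Schwarz per product
  have hCSa : ∫ x, a x * c x ≤ Real.sqrt (∫ x, a x ^ 2) * Real.sqrt (∫ x, c x ^ 2) :=
    integral_norm_mul_norm_le_sqrt_sq_mul_sqrt_sq (hw.memLp 2) (hΔw.memLp 2)
  have hCSb : ∀ m, ∫ x, b m x * c x ≤ Real.sqrt (∫ x, b m x ^ 2) * Real.sqrt (∫ x, c x ^ 2) := fun m =>
    integral_norm_mul_norm_le_sqrt_sq_mul_sqrt_sq ((hw.partialDeriv m).memLp 2) (hΔw.memLp 2)
  have hCSc : ∫ x, c x * c x ≤ Real.sqrt (∫ x, c x ^ 2) * Real.sqrt (∫ x, c x ^ 2) :=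
    integral_norm_mul_norm_le_sqrt_sq_mul_sqrt_sq (hΔw.memLp 2) (hΔw.memLp 2)
  have hsumb : (∑ m, ∫ x, b m x * c x) ≤ ∑ m, Real.sqrt (∫ x, b m x ^ 2) * Real.sqrt (∫ x, c x ^ 2) :=
    Finset.sum_le_sum fun m _ => hCSb m
  calc |∫ x, ⟪convect w v x, laplacian (laplacian w) x⟫|
      = |∫ x, ⟪R x, laplacian w x⟫| := by rw [hgreen]
    _ ≤ ∫ x, ‖R x‖ * c x := hint_le
    _ ≤ ∫ x, B x := hmono
    _ = N * (L'' * (∫ x, a x * c x) + 2 * L' * (∑ m, ∫ x, b m x * c x) + L * (∫ x, c x * c x)) := hBint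
    _ ≤ N * (L'' * (Real.sqrt (∫ x, a x ^ 2) * Real.sqrt (∫ x, c x ^ 2))
        + 2 * L' * (∑ m, Real.sqrt (∫ x, b m x ^ 2) * Real.sqrt (∫ x, c x ^ 2))
        + L * (Real.sqrt (∫ x, c x ^ 2) * Real.sqrt (∫ x, c x ^ 2))) := by
        have h2L : 0 ≤ 2 * L' := by linarith
        exact mul_le_mul_of_nonneg_left (add_le_add (add_le_add
          (mul_le_mul_of_nonneg_left hCSa hL''0) (mul_le_mul_of_nonneg_left hsumb h2L))
          (mul_le_mul_of_nonneg_left hCSc hL0)) hN0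
    _ = N * (L'' * Real.sqrt (∫ x, a x ^ 2) + 2 * L' * (∑ m, Real.sqrt (∫ x, b m x ^ 2))
        + L * Real.sqrt (∫ x, c x ^ 2)) * Real.sqrt (∫ x, c x ^ 2) := by
        have f2 : (∑ m, Real.sqrt (∫ x, b m x ^ 2) * Real.sqrt (∫ x, c x ^ 2))
            = (∑ m, Real.sqrt (∫ x, b m x ^ 2)) * Real.sqrt (∫ x, c x ^ 2) := (Finset.sum_mul _ _ _).symm
        rw [f2]; ring

/-- **The linearised `H²` flux without `ν⁻¹`.** Adding the transport and stretching halves: for smooth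
divergence-free `v` with pointwise derivative bounds `L, L', L''` and `‖Δv‖ ≤ L₂`, and smooth `w`,
`|∫ ⟪(v·∇)w + (w·∇)v, ΔΔw⟫| ≤ [2L·ΣΣ‖∂∂w‖₂ + L₂·Σ‖∂w‖₂ + d(L''‖w‖₂ + 2L'·Σ‖∂w‖₂ + L‖Δw‖₂)]·‖Δw‖₂`
— every constant LINEAR in the host's derivative bounds; compare the tree's
`Torus.linearisedNS_laplacian_flux_le` whose right side carries `ν⁻¹M²`. For the ABC host this is the
analytic content of THEOREM 3-L's tail (§11 l.109) and of LEMMA R (R2′). -/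
theorem abs_integral_inner_linearised_bilaplacian_le {v w : UnitAddTorus d → EuclideanSpace ℝ d}
    (hv : IsSmooth v) (hdiv : IsDivFree v) (hw : IsSmooth w) {L L' L'' L₂ : ℝ}
    (hL0 : 0 ≤ L) (hL'0 : 0 ≤ L') (hL''0 : 0 ≤ L'')
    (hL : ∀ (k : d) (x : UnitAddTorus d), ‖partialDeriv k v x‖ ≤ L)
    (hL' : ∀ (j k : d) (x : UnitAddTorus d), ‖partialDeriv j (partialDeriv k v) x‖ ≤ L')
    (hL'' : ∀ (j : d) (x : UnitAddTorus d), ‖partialDeriv j (laplacian v) x‖ ≤ L'')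
    (hL₂ : ∀ x : UnitAddTorus d, ‖laplacian v x‖ ≤ L₂) :
    |∫ x, ⟪convect v w x + convect w v x, laplacian (laplacian w) x⟫|
      ≤ ((2 * L * (∑ m, ∑ j, Real.sqrt (∫ x, ‖partialDeriv j (partialDeriv m w) x‖ ^ 2))
            + L₂ * (∑ j, Real.sqrt (∫ x, ‖partialDeriv j w x‖ ^ 2)))
          + (Fintype.card d : ℝ) * (L'' * Real.sqrt (∫ x, ‖w x‖ ^ 2)
            + 2 * L' * (∑ m, Real.sqrt (∫ x, ‖partialDeriv m w x‖ ^ 2))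
            + L * Real.sqrt (∫ x, ‖laplacian w x‖ ^ 2)))
        * Real.sqrt (∫ x, ‖laplacian w x‖ ^ 2) := by
  have hΔΔ : IsSmooth (laplacian (laplacian w)) := hw.laplacian.laplacian
  have h1 := abs_integral_inner_convect_bilaplacian_le hv hdiv hw hL0 hL hL₂
  have h2 := abs_integral_inner_stretch_bilaplacian_le hv hw hL0 hL'0 hL''0 hL hL' hL''
  have hi1 : Integrable (fun x => ⟪convect v w x, laplacian (laplacian w) x⟫) volume :=
    (((hv.convect hw).continuous).inner hΔΔ.continuous).integrable_of_hasCompactSupport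
      (HasCompactSupport.of_compactSpace _)
  have hi2 : Integrable (fun x => ⟪convect w v x, laplacian (laplacian w) x⟫) volume :=
    (((hw.convect hv).continuous).inner hΔΔ.continuous).integrable_of_hasCompactSupport
      (HasCompactSupport.of_compactSpace _)
  have e : ∫ x, ⟪convect v w x + convect w v x, laplacian (laplacian w) x⟫
      = (∫ x, ⟪convect v w x, laplacian (laplacian w) x⟫)
        + ∫ x, ⟪convect w v x, laplacian (laplacian w) x⟫ := by
    simp_rw [inner_add_left]
    exact integral_add hi1 hi2
  rw [e, add_mul]
  exact (abs_add_le _ _).trans (add_le_add h1 h2)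

end Summit.NavierStokesRegularity.FluidComputer.LaplacianConvectFlux
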